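import Summits.NavierStokesRegularity.OSWSelfSimilar.SheetNSLineTorusCascadeScaling
import Summits.NavierStokesRegularity.OSWSelfSimilar.SheetNSLineTorusCascadeComparison
import Summits.NavierStokesRegularity.OSWSelfSimilar.SheetNSLineTorusCascadeSynthesis
import Summits.NavierStokesRegularity.OSWSelfSimilar.SheetNSLineTorusCascadeLinkUnique
import HarnessLib

/-!
# Viscous CLM on the torus (`a = 0`, `σ = 2`): the CERTIFIED-TAIL PLUG (global side) — ONE tail majorant `E_k ≤ 12 k μ₀^k` for the
# universal family ⇒ a geometric envelope for EVERY sine cascade with `c μ₀ < ν` ⇒ a GLOBAL CLASSICAL SOLUTION of the MODEL PDE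
# from `−c sin x` (composition with the synthesis theorem)

HONEST FRAMING (cell ns-blowup GROUP B «PROFILE SEARCH», zone Z3, row Z3-U addendum A-F2 of `HOME/profile/z3/CENSUS-Z3.md`;
human rulings D-0035/D-0074; Z3-TWIN lineage): **1-D MODEL (viscous Constantin–Lax–Majda equation `ω_t = ω Hω + ν ω_xx` on `𝕋`,
`H = hilbertTransformCircle`); kernel-checked composition of an ODE comparison principle with the cascade ⇒ classical-solution
synthesis; not Euler, not Navier–Stokes; «violates: none — MODEL». No number is certified by THIS file: the window tables are a NAMED
HYPOTHESIS (`hwin`), supplied outside the kernel by a directed-rounding script (see READING).**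

OBJECTS. The universal family `E := cascadeSolution 1 (sineDatum 1)` and the dictionary `c_k^{(ν,c)}(t) = ν (c/ν)^k E_k(νt)`
(`SheetNSLineTorusCascadeScaling`); the constant-tail comparison form `le_const_of_pointwise_sup` (`SheetNSLineTorusCascadeComparison`,
p509398); the stationary-pole bound `mode_le_stationaryPole` (`E_k ≤ 12 k 12^{−k}`); the synthesis theorem `isClassicalSolution_synth`
(`SheetNSLineTorusCascadeSynthesis`, eng-3 g9: a sine cascade under a geometric envelope `|e_k(t)| ≤ A k q^k`, `q < 1`, IS a classical
solution of the MODEL PDE on every horizon, via the series `synthOmega`).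

THEOREMS:
* `universal_tail_of_window_tables` — the certificate-facing form: window head tables for `E` (hypothesis `hwin` of
  `le_const_of_pointwise_sup` at `ν = c = 1`, `u_k = 12 k μ₀^k`, from `k₀ ≥ 2` on) ⇒ `E_k(τ) ≤ 12 k μ₀^k` for all `k ≥ k₀`, `τ ≥ 0`;
* `cascadeSolution_le_of_universal_tail` / `abs_cascadeSolution_le_of_universal_tail` — such a tail majorant with `12 μ₀ ≤ 1` gives, for
  EVERY `ν > 0`, `c ≥ 0`, the geometric envelope `0 ≤ c_k^{(ν,c)}(t) ≤ 12ν(12μ₀)^{−k₀}·k·(cμ₀/ν)^k` (head modes `k < k₀` by the stationary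
  pole, tail by the table; the factor `(12μ₀)^{−k₀} ≥ 1` absorbs the head);
* `isClassicalSolution_of_universal_tail`, `exists_global_classicalSolution_of_universal_tail` — **PDE level**: for every `ν > 0` and every
  `0 ≤ c` with `c μ₀ < ν` the series of `cascadeSolution ν (sineDatum c)` is a classical `2π`-periodic solution of the MODEL PDE with
  `ω(0,·) = −c sin` on `[0, T]` for EVERY `T` (global classical solution);
* `exists_global_classicalSolution_of_window_tables` — the same directly from the window tables.
READING (what is OUTSIDE the kernel). Theorem A of the Z3-TWIN certificate (`HOME/profile/z3twin/engine/cascade/cert_lower.py`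
34e4372cb9e1be71, certificate `runs/Z3-cascade-CERT_j271042/outputs/cert_lower_eta1e-6.json` 9cb536a2d01acfc9, exact-rational re-check
`check_cert_lower.py` ALL OK, second-seat re-check profile-refuter g6 STATUS l.8527) supplies an instance of `hwin`: `k₀ = 65`,
`μ₀ = (1 + 10⁻⁶)/19.775567578656…` (so `12 μ₀ < 1`), 110 time windows with rigorous head sups `H`. WITH THAT DATUM the theorems read:
**for every `ν > 0` and every `0 ≤ c < ν/μ₀ = 19.7755478·ν` the MODEL PDE `ω_t = ω Hω + ν ω_xx` on `𝕋` has a GLOBAL classical solution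
from `ω₀ = −c sin x`** — the lower side of the bracket of record `19.7755478 ≤ c*/ν ≤ 19.7766876` as «SCRIPT datum + ONE kernel
theorem at the PDE level» (the upper side: `SheetNSLineTorusCascadeLinkCertified`). The fully-kernel (datum-free) sentence remains
`exists_global_classicalSolution_of_lt_twelve` (`c < 12ν`). What stays PRINT: uniqueness of the classical solution (so «the» solution
reads «a» solution; ALSS 2024 §3). bears_on: LADDER-NS N5 / zone Z3 (row Z3-U) → N1 linear core. WHAT THIS IS NOT: not NS; no
definitions; no number certified here.
-/

namespace Summit.NavierStokesRegularity.OSWSelfSimilar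
namespace SheetNSLineTorusCascade

open Finset Real Set

variable {ν c : ℝ}

/-- **WINDOW TABLES ⇒ UNIVERSAL TAIL MAJORANT** (the certificate-facing form, `le_const_of_pointwise_sup` at `ν = c = 1` with the constant
tail `u_k = 12 k μ₀^k`): if for every `k ≥ k₀` (`k₀ ≥ 2`) and every `t > 0` there is a head table `H` with `E_i(t) ≤ H_i` (`i < k₀`) and
`½ Σ_{i+j=k} Ĥ_i Ĥ_j ≤ k²·12kμ₀^k` (`Ĥ_i = H_i` for `i < k₀`, `12 i μ₀^i` for `i ≥ k₀`), then `E_k(τ) ≤ 12 k μ₀^k` for all `k ≥ k₀`,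
`τ ≥ 0`. [new here — MODEL] -/
theorem universal_tail_of_window_tables {μ₀ : ℝ} (hμ₀ : 0 ≤ μ₀) {k₀ : ℕ} (hk₀ : 2 ≤ k₀)
    (hwin : ∀ k, k₀ ≤ k → ∀ t : ℝ, 0 < t → ∃ H : ℕ → ℝ,
      (∀ i, i < k₀ → cascadeSolution 1 (sineDatum 1) i t ≤ H i) ∧
      (1 / 2) * ∑ p ∈ antidiagonal k,
          (if p.1 < k₀ then H p.1 else 12 * (p.1 : ℝ) * μ₀ ^ p.1) * (if p.2 < k₀ then H p.2 else 12 * (p.2 : ℝ) * μ₀ ^ p.2)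
        ≤ (k : ℝ) ^ 2 * (12 * (k : ℝ) * μ₀ ^ k)) :
    ∀ k, k₀ ≤ k → ∀ τ : ℝ, 0 ≤ τ → cascadeSolution 1 (sineDatum 1) k τ ≤ 12 * (k : ℝ) * μ₀ ^ k := by
  refine le_const_of_pointwise_sup (isSineCascade_cascadeSolution 1 1) zero_le_one hk₀ (fun k => 12 * (k : ℝ) * μ₀ ^ k)
    (fun k _ => by positivity) fun k hk t ht => ?_
  obtain ⟨H, hH, hineq⟩ := hwin k hk t ht
  refine ⟨H, hH, ?_⟩
  simpa only [one_mul] using hineq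

/-- **UNIVERSAL TAIL MAJORANT ⇒ GEOMETRIC ENVELOPE FOR EVERY `(ν, c)`.** If `E_k(τ) ≤ 12 k μ₀^k` for `k ≥ k₀`, `τ ≥ 0`, with `0 < μ₀`,
`12 μ₀ ≤ 1`, then for every `ν > 0`, `c ≥ 0`, `k`, `t ≥ 0`:
`cascadeSolution ν (sineDatum c) k t ≤ 12ν·(12μ₀)^{−k₀}·k·(cμ₀/ν)^k` (head modes by the stationary pole `E_k ≤ 12k·12^{−k}`).
[new here — MODEL] -/
theorem cascadeSolution_le_of_universal_tail {μ₀ : ℝ} (hμ₀ : 0 < μ₀) (h12μ : 12 * μ₀ ≤ 1) {k₀ : ℕ}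
    (tail : ∀ k, k₀ ≤ k → ∀ τ : ℝ, 0 ≤ τ → cascadeSolution 1 (sineDatum 1) k τ ≤ 12 * (k : ℝ) * μ₀ ^ k)
    (hν : 0 < ν) (hc : 0 ≤ c) (k : ℕ) (t : ℝ) (ht : 0 ≤ t) :
    cascadeSolution ν (sineDatum c) k t ≤ 12 * ν * (12 * μ₀)⁻¹ ^ k₀ * (k : ℝ) * (c * μ₀ / ν) ^ k := by
  have hE : IsSineCascade 1 1 (cascadeSolution 1 (sineDatum 1)) := isSineCascade_cascadeSolution 1 1
  have hB : 1 ≤ (12 * μ₀)⁻¹ := one_le_inv_iff₀.mpr ⟨by positivity, h12μ⟩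
  have hBk₀ : 1 ≤ (12 * μ₀)⁻¹ ^ k₀ := one_le_pow₀ hB
  have hνt : 0 ≤ ν * t := mul_nonneg hν.le ht
  have hcν : 0 ≤ c / ν := div_nonneg hc hν.le
  have hq : 0 ≤ c * μ₀ / ν := div_nonneg (mul_nonneg hc hμ₀.le) hν.le
  rw [cascadeSolution_sine_eq_universal hν c k t ht]
  -- the common rewriting `ν (c/ν)^k · 12 k μ₀^k · B^m = 12 ν B^m k (cμ₀/ν)^k`
  have hid : ∀ m : ℕ, ν * (c / ν) ^ k * (12 * (k : ℝ) * μ₀ ^ k * (12 * μ₀)⁻¹ ^ m)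
      = 12 * ν * (12 * μ₀)⁻¹ ^ m * (k : ℝ) * (c * μ₀ / ν) ^ k := by
    intro m
    rw [mul_div_assoc, mul_pow c, div_eq_mul_inv c ν, mul_pow c]
    ring
  rcases Nat.lt_or_ge k k₀ with hk | hk
  · -- head mode: stationary pole `E_k ≤ 12 k (1/12)^k = 12 k μ₀^k · (12μ₀)^{-k} ≤ 12 k μ₀^k · B^{k₀}`
    have hpole := mode_le_stationaryPole hE one_pos zero_le_one k (ν * t) hνt
    have hμ0 : μ₀ ≠ 0 := hμ₀.ne'
    have h12 : 12 * (1 : ℝ) * (k : ℝ) * (1 / (12 * 1)) ^ k = 12 * (k : ℝ) * μ₀ ^ k * (12 * μ₀)⁻¹ ^ k := by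
      have hμ : μ₀ ^ k * (12 * μ₀)⁻¹ ^ k = (1 / 12) ^ k := by
        rw [← mul_pow]
        congr 1
        field_simp
      rw [mul_assoc (12 * (k : ℝ)), hμ]
      ring
    rw [h12] at hpole
    have hmono : (12 * μ₀)⁻¹ ^ k ≤ (12 * μ₀)⁻¹ ^ k₀ := pow_le_pow_right₀ hB hk.le
    calc ν * (c / ν) ^ k * cascadeSolution 1 (sineDatum 1) k (ν * t)
        ≤ ν * (c / ν) ^ k * (12 * (k : ℝ) * μ₀ ^ k * (12 * μ₀)⁻¹ ^ k) :=
          mul_le_mul_of_nonneg_left hpole (by positivity)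
      _ ≤ ν * (c / ν) ^ k * (12 * (k : ℝ) * μ₀ ^ k * (12 * μ₀)⁻¹ ^ k₀) := by gcongr
      _ = 12 * ν * (12 * μ₀)⁻¹ ^ k₀ * (k : ℝ) * (c * μ₀ / ν) ^ k := hid k₀
  · -- tail mode: the table
    have htl := tail k hk (ν * t) hνt
    calc ν * (c / ν) ^ k * cascadeSolution 1 (sineDatum 1) k (ν * t)
        ≤ ν * (c / ν) ^ k * (12 * (k : ℝ) * μ₀ ^ k * (12 * μ₀)⁻¹ ^ 0) := by
          rw [pow_zero, mul_one]; exact mul_le_mul_of_nonneg_left htl (by positivity)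
      _ ≤ ν * (c / ν) ^ k * (12 * (k : ℝ) * μ₀ ^ k * (12 * μ₀)⁻¹ ^ k₀) := by rw [pow_zero]; gcongr
      _ = 12 * ν * (12 * μ₀)⁻¹ ^ k₀ * (k : ℝ) * (c * μ₀ / ν) ^ k := hid k₀

/-- The same envelope in absolute value (the modes are nonnegative). [new here — MODEL] -/
theorem abs_cascadeSolution_le_of_universal_tail {μ₀ : ℝ} (hμ₀ : 0 < μ₀) (h12μ : 12 * μ₀ ≤ 1) {k₀ : ℕ}
    (tail : ∀ k, k₀ ≤ k → ∀ τ : ℝ, 0 ≤ τ → cascadeSolution 1 (sineDatum 1) k τ ≤ 12 * (k : ℝ) * μ₀ ^ k)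
    (hν : 0 < ν) (hc : 0 ≤ c) : ∀ k : ℕ, ∀ t : ℝ, 0 ≤ t →
      |cascadeSolution ν (sineDatum c) k t| ≤ 12 * ν * (12 * μ₀)⁻¹ ^ k₀ * (k : ℝ) * (c * μ₀ / ν) ^ k := by
  intro k t ht
  rw [abs_of_nonneg (nonneg (isSineCascade_cascadeSolution ν c) hc k t ht)]
  exact cascadeSolution_le_of_universal_tail hμ₀ h12μ tail hν hc k t ht

/-- **PDE LEVEL: GLOBAL CLASSICAL SOLUTION FOR `c μ₀ < ν` FROM A UNIVERSAL TAIL MAJORANT.** If `E_k(τ) ≤ 12 k μ₀^k` for `k ≥ k₀`,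
`τ ≥ 0` (`0 < μ₀`, `12μ₀ ≤ 1`), then for every `ν > 0` and `0 ≤ c` with `c μ₀ < ν` the series of `cascadeSolution ν (sineDatum c)` is a
classical `2π`-periodic solution of `ω_t = ω·Hω + ν ω_xx` on `[0, T]` for EVERY `T`. [new here — MODEL] -/
theorem isClassicalSolution_of_universal_tail {μ₀ : ℝ} (hμ₀ : 0 < μ₀) (h12μ : 12 * μ₀ ≤ 1) {k₀ : ℕ}
    (tail : ∀ k, k₀ ≤ k → ∀ τ : ℝ, 0 ≤ τ → cascadeSolution 1 (sineDatum 1) k τ ≤ 12 * (k : ℝ) * μ₀ ^ k)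
    (hν : 0 < ν) (hc : 0 ≤ c) (hcμ : c * μ₀ < ν) (T : ℝ) :
    IsClassicalSolution ν T (synthOmega (cascadeSolution ν (sineDatum c))) (synthOmegaT ν (cascadeSolution ν (sineDatum c)))
      (synthOmegaX (cascadeSolution ν (sineDatum c))) (synthOmegaXX (cascadeSolution ν (sineDatum c))) :=
  isClassicalSolution_synth (isSineCascade_cascadeSolution ν c) (by positivity : (0 : ℝ) ≤ 12 * ν * (12 * μ₀)⁻¹ ^ k₀)
    (div_nonneg (mul_nonneg hc hμ₀.le) hν.le) ((div_lt_one hν).mpr hcμ)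
    (abs_cascadeSolution_le_of_universal_tail hμ₀ h12μ tail hν hc) T

/-- **Existence, packaged.** Under a universal tail majorant `E_k ≤ 12 k μ₀^k` (`k ≥ k₀`, all `τ ≥ 0`; `0 < μ₀`, `12μ₀ ≤ 1`): for every
`ν > 0` and `0 ≤ c < ν/μ₀` there is one quadruple `(ω, ωt, ωx, ωxx)` with `ω(0,·) = −c sin` which is a classical solution of the MODEL
PDE on `[0, T]` for every `T`. With the Z3-TWIN script datum (`k₀ = 65`, `1/μ₀ = 19.7755478…`): a GLOBAL classical solution from
`−c sin x` for every `0 ≤ c < 19.7755478·ν`. [new here — MODEL] -/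
theorem exists_global_classicalSolution_of_universal_tail {μ₀ : ℝ} (hμ₀ : 0 < μ₀) (h12μ : 12 * μ₀ ≤ 1) {k₀ : ℕ}
    (tail : ∀ k, k₀ ≤ k → ∀ τ : ℝ, 0 ≤ τ → cascadeSolution 1 (sineDatum 1) k τ ≤ 12 * (k : ℝ) * μ₀ ^ k)
    (hν : 0 < ν) (hc : 0 ≤ c) (hcμ : c * μ₀ < ν) :
    ∃ ω ωt ωx ωxx : ℝ → ℝ → ℝ, (∀ x, ω 0 x = -c * Real.sin x) ∧ ∀ T : ℝ, IsClassicalSolution ν T ω ωt ωx ωxx :=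
  ⟨_, _, _, _, synthOmega_cascadeSolution_zero c, isClassicalSolution_of_universal_tail hμ₀ h12μ tail hν hc hcμ⟩

/-- **PDE LEVEL, CERTIFICATE-FACING FORM.** Window head tables for the universal family (`hwin` of `le_const_of_pointwise_sup` at
`ν = c = 1` with `u_k = 12 k μ₀^k`, `k₀ ≥ 2`, `0 < μ₀`, `12μ₀ ≤ 1`) ⇒ for every `ν > 0` and `0 ≤ c < ν/μ₀` a GLOBAL classical solution
of the MODEL PDE from `−c sin x`. [new here — MODEL] -/
theorem exists_global_classicalSolution_of_window_tables {μ₀ : ℝ} (hμ₀ : 0 < μ₀) (h12μ : 12 * μ₀ ≤ 1) {k₀ : ℕ} (hk₀ : 2 ≤ k₀)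
    (hwin : ∀ k, k₀ ≤ k → ∀ t : ℝ, 0 < t → ∃ H : ℕ → ℝ,
      (∀ i, i < k₀ → cascadeSolution 1 (sineDatum 1) i t ≤ H i) ∧
      (1 / 2) * ∑ p ∈ antidiagonal k,
          (if p.1 < k₀ then H p.1 else 12 * (p.1 : ℝ) * μ₀ ^ p.1) * (if p.2 < k₀ then H p.2 else 12 * (p.2 : ℝ) * μ₀ ^ p.2)
        ≤ (k : ℝ) ^ 2 * (12 * (k : ℝ) * μ₀ ^ k))
    (hν : 0 < ν) (hc : 0 ≤ c) (hcμ : c * μ₀ < ν) :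
    ∃ ω ωt ωx ωxx : ℝ → ℝ → ℝ, (∀ x, ω 0 x = -c * Real.sin x) ∧ ∀ T : ℝ, IsClassicalSolution ν T ω ωt ωx ωxx :=
  exists_global_classicalSolution_of_universal_tail hμ₀ h12μ (universal_tail_of_window_tables hμ₀.le hk₀ hwin) hν hc hcμ

/-! ### Appended (v2): uniqueness — every classical solution below the certified constant IS the synthesized one -/

/-- **IDENTIFICATION (v2 append; eng-3 g9's generic slot `IsClassicalSolution.eq_synth_of_envelope`, p517918, fed with the universal-tail
envelope).** Under a universal tail majorant `E_k ≤ 12 k μ₀^k` (`k ≥ k₀`, all `τ ≥ 0`; `0 < μ₀`, `12μ₀ ≤ 1`): for every `ν > 0` and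
`0 ≤ c` with `c μ₀ < ν`, EVERY classical `2π`-periodic solution of the MODEL PDE on `[0, T]` (`T > 0`) from `−c sin x` coincides on
`[0, T] × ℝ` with the synthesized global solution `synthOmega (cascadeSolution ν (sineDatum c))` — with the Z3-TWIN script datum: for
`0 ≤ c < 19.7755478·ν` THE classical solution from `−c sin x` exists globally and is unique on every horizon. [new here — MODEL] -/
theorem IsClassicalSolution.eq_synth_of_universal_tail {μ₀ : ℝ} (hμ₀ : 0 < μ₀) (h12μ : 12 * μ₀ ≤ 1) {k₀ : ℕ}
    (tail : ∀ k, k₀ ≤ k → ∀ τ : ℝ, 0 ≤ τ → cascadeSolution 1 (sineDatum 1) k τ ≤ 12 * (k : ℝ) * μ₀ ^ k)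
    {T : ℝ} {ω ωt ωx ωxx : ℝ → ℝ → ℝ} (h : IsClassicalSolution ν T ω ωt ωx ωxx) (hω0 : ∀ x, ω 0 x = -c * Real.sin x)
    (hν : 0 < ν) (hc : 0 ≤ c) (hcμ : c * μ₀ < ν) (hT : 0 < T) {t : ℝ} (ht : t ∈ Icc (0 : ℝ) T) (x : ℝ) :
    ω t x = synthOmega (cascadeSolution ν (sineDatum c)) t x :=
  h.eq_synth_of_envelope hω0 (isSineCascade_cascadeSolution ν c) (by positivity : (0 : ℝ) ≤ 12 * ν * (12 * μ₀)⁻¹ ^ k₀)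
    (div_nonneg (mul_nonneg hc hμ₀.le) hν.le) ((div_lt_one hν).mpr hcμ)
    (abs_cascadeSolution_le_of_universal_tail hμ₀ h12μ tail hν hc) hT ht x

/-- **IDENTIFICATION, CERTIFICATE-FACING FORM (v2 append).** The same directly from the window head tables `hwin` for the universal family
(`k₀ ≥ 2`). [new here — MODEL] -/
theorem IsClassicalSolution.eq_synth_of_window_tables {μ₀ : ℝ} (hμ₀ : 0 < μ₀) (h12μ : 12 * μ₀ ≤ 1) {k₀ : ℕ} (hk₀ : 2 ≤ k₀)
    (hwin : ∀ k, k₀ ≤ k → ∀ t : ℝ, 0 < t → ∃ H : ℕ → ℝ,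
      (∀ i, i < k₀ → cascadeSolution 1 (sineDatum 1) i t ≤ H i) ∧
      (1 / 2) * ∑ p ∈ antidiagonal k,
          (if p.1 < k₀ then H p.1 else 12 * (p.1 : ℝ) * μ₀ ^ p.1) * (if p.2 < k₀ then H p.2 else 12 * (p.2 : ℝ) * μ₀ ^ p.2)
        ≤ (k : ℝ) ^ 2 * (12 * (k : ℝ) * μ₀ ^ k))
    {T : ℝ} {ω ωt ωx ωxx : ℝ → ℝ → ℝ} (h : IsClassicalSolution ν T ω ωt ωx ωxx) (hω0 : ∀ x, ω 0 x = -c * Real.sin x)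
    (hν : 0 < ν) (hc : 0 ≤ c) (hcμ : c * μ₀ < ν) (hT : 0 < T) {t : ℝ} (ht : t ∈ Icc (0 : ℝ) T) (x : ℝ) :
    ω t x = synthOmega (cascadeSolution ν (sineDatum c)) t x :=
  h.eq_synth_of_universal_tail hμ₀ h12μ (universal_tail_of_window_tables hμ₀.le hk₀ hwin) hω0 hν hc hcμ hT ht x

end SheetNSLineTorusCascade
end Summit.NavierStokesRegularity.OSWSelfSimilar
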